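import Mathlib.LinearAlgebra.Eigenspace.Triangularizable
import Mathlib.LinearAlgebra.Projection
import Mathlib.LinearAlgebra.Trace
import Mathlib.RepresentationTheory.Basic
import Mathlib.Tactic.Group
import HarnessLib

/-!
# Clifford theory for a cyclic quotient: reducible restriction forces a twist

Topic `Literature/RepresentationTheory/Semisimple`.  Everything in this file is PROVED (no
definition, no named fact); only Mathlib is used.

Setting: a representation `R` of a group `G` on a finite-dimensional vector space `V` over an
algebraically closed field `K`, a normal subgroup `N ⊴ G` and `g₀ ∈ G` with `G = ⋃ⱼ g₀ ^ j N`
(cyclic quotient) and `g₀ ^ m ∈ N` for some `m` invertible in `K`.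

Main result `exists_twist_scalar_of_reducible_restrict`: if every `G`-stable subspace of `V` is
`⊥` or `⊤` but some `N`-stable subspace is neither, then there is a scalar `ν ≠ 1` with
`ν ^ dim V = 1` and `tr R(g₀ ^ j n) = ν ^ j · tr R(g₀ ^ j n)` for all `j` and all `n ∈ N`.
Informally: `V ≅ V ⊗ χ` for the nontrivial character `χ(g₀ ^ j n) = ν ^ j` of `G / N`, so the
character of `V` vanishes off `ker χ ⊋ N` — the classical dichotomy "`V|_N` irreducible, or `V` is
isomorphic to a nontrivial twist by a character of `G/N`" of Clifford theory for cyclic `G/N`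
(A. H. Clifford, Ann. of Math. 38 (1937); Curtis–Reiner, *Representation Theory of Finite Groups
and Associative Algebras* (1962), §49–§51), in the trace form used for residual Galois
representations restricted to `Γ_{ℚ(ζ_ℓ)} = ker ε̄_ℓ` (consumer:
`Summits/Langlands/Langlands/Theorems/AbelianSurfaceSerreSerreGSp4SurjectiveStubCoxeterAdequate`).

Proof.  Take an `N`-stable `W₁ ≠ ⊥` of minimal dimension; the partial sums of its translates
`g₀ ^ i W₁` stabilise at a `G`-stable subspace, hence at `V`, and the last step exhibits
`V = X ⊕ D` with `X, D ≠ ⊥` both `N`-stable.  The projection `p` onto `X` along `D` commutes with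
`R(N)` but not with `T = R(g₀)` (else `X` would be `G`-stable).  Conjugation `Φ = Ad T` acts on
the commutant `E` of `R(N)` with `Φ ^ m = 1` on `E`; on `E' = (Φ - 1) E ∋ Φ p - p ≠ 0` it has no
nonzero fixed vector (a telescoping sum, using `m ≠ 0` in `K`), so an eigenvector `f ∈ E'` of `Φ`
has eigenvalue `ν ≠ 1`.  Its kernel is `G`-stable and `f ≠ 0`, so `f` is invertible, and
`f⁻¹ R(g₀ ^ j n) f = ν ^ j R(g₀ ^ j n)`; taking traces, and the determinant at `j = 1`, gives the
claim.  Stability of a subspace `W` under `R g` is phrased as `W.map (R g) ≤ W` throughout.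

## References

* A. H. Clifford, *Representations induced in an invariant subgroup*, Ann. of Math. (2) 38
  (1937), 533–550. [Clifford1937]
* C. W. Curtis, I. Reiner, *Representation Theory of Finite Groups and Associative Algebras*
  (1962), §49–§51. [CurtisReiner1962]
-/

noncomputable section

namespace Literature.RepresentationTheory.Semisimple

open Module

section CliffordCyclicTwist

variable {K V G : Type*} [Field K] [AddCommGroup V] [Module K V] [Group G]
  (R : Representation K G V) (N : Subgroup G)

/-- `map` along `R (a * b)` is `map` along `R b` followed by `map` along `R a`. [folklore] -/
theorem submodule_map_rep_mul (a b : G) (W : Submodule K V) :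
    W.map (R (a * b)) = (W.map (R b)).map (R a) := by
  rw [map_mul, Module.End.mul_eq_comp, Submodule.map_comp]

/-- A translate `R g • W` of an `N`-stable subspace `W` is `N`-stable (`N` normal). [folklore] -/
theorem submodule_map_rep_stable_of_normal [N.Normal] {W : Submodule K V}
    (hW : ∀ n ∈ N, W.map (R n) ≤ W) (g : G) : ∀ n ∈ N, (W.map (R g)).map (R n) ≤ W.map (R g) := by
  intro n hn
  have h : n * g = g * (g⁻¹ * n * g) := by group
  rw [← submodule_map_rep_mul, h, submodule_map_rep_mul]
  exact Submodule.map_mono (hW _ (Subgroup.Normal.conj_mem' inferInstance n hn g))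

/-- If `G = ⋃ⱼ g₀ ^ j • N`, a subspace stable under `R g₀` and `R n` (`n ∈ N`) is `G`-stable.
[folklore] -/
theorem submodule_map_rep_le_of_generator {g₀ : G}
    (hgen : ∀ g : G, ∃ (j : ℕ) (n : G), n ∈ N ∧ g = g₀ ^ j * n)
    {W : Submodule K V} (hT : W.map (R g₀) ≤ W) (hW : ∀ n ∈ N, W.map (R n) ≤ W) (g : G) :
    W.map (R g) ≤ W := by
  obtain ⟨j, n, hn, rfl⟩ := hgen g
  rw [submodule_map_rep_mul]
  refine (Submodule.map_mono (hW n hn)).trans ?_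
  induction j with
  | zero => simp only [pow_zero, map_one, Module.End.one_eq_id, Submodule.map_id, le_refl]
  | succ j ih =>
      rw [pow_succ, submodule_map_rep_mul]
      exact (Submodule.map_mono hT).trans ih

variable [FiniteDimensional K V]

omit [FiniteDimensional K V] in
/-- The operators `R g` of a group representation are injective. [folklore] -/
theorem rep_apply_injective (g : G) : Function.Injective (R g) := fun x y h => by
  simpa [← Module.End.mul_apply, ← map_mul] using congrArg (R g⁻¹) h

/-- **Clifford twist.**  Let `N ⊴ G` with `G = ⋃ⱼ g₀ ^ j • N`, `g₀ ^ m ∈ N`, `m ≠ 0` in the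
algebraically closed field `K`, and let `V` be a finite-dimensional `K[G]`-module all of whose
`G`-stable subspaces are `⊥` or `⊤`.  If `V` has an `N`-stable subspace `W ≠ ⊥, ⊤`, then there is
`ν ≠ 1` with `ν ^ dim V = 1` and `tr R(g₀ ^ j n) = ν ^ j · tr R(g₀ ^ j n)` for all `j` and
`n ∈ N` (so `V ≅ V ⊗ χ` for the character `χ(g₀ ^ j n) = ν ^ j` of `G/N`, and `tr R` vanishes
off `ker χ`).  A slice of Clifford theory for a normal subgroup with cyclic quotient
(Clifford 1937; Curtis–Reiner (1962) §49–§51). [folklore] -/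
theorem exists_twist_scalar_of_reducible_restrict [IsAlgClosed K] [N.Normal] (g₀ : G)
    (hgen : ∀ g : G, ∃ (j : ℕ) (n : G), n ∈ N ∧ g = g₀ ^ j * n)
    (m : ℕ) (hm : g₀ ^ m ∈ N) (hm0 : (m : K) ≠ 0)
    (hirr : ∀ W : Submodule K V, (∀ g, W.map (R g) ≤ W) → W = ⊥ ∨ W = ⊤)
    (W : Submodule K V) (hW : ∀ n ∈ N, W.map (R n) ≤ W) (hW0 : W ≠ ⊥) (hW1 : W ≠ ⊤) :
    ∃ ν : K, ν ≠ 1 ∧ ν ^ finrank K V = 1 ∧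
      ∀ (j : ℕ) (n : G), n ∈ N →
        LinearMap.trace K V (R (g₀ ^ j * n)) = ν ^ j * LinearMap.trace K V (R (g₀ ^ j * n)) := by
  classical
  -- the generator and its inverse
  set T : Module.End K V := R g₀ with hTdef
  set T' : Module.End K V := R g₀⁻¹ with hT'def
  have hTT' : T * T' = 1 := by rw [hTdef, hT'def, ← map_mul, mul_inv_cancel, map_one]
  have hT'T : T' * T = 1 := by rw [hTdef, hT'def, ← map_mul, inv_mul_cancel, map_one]
  -- Step 1: an `N`-stable subspace `W₁ ≠ ⊥` of minimal dimension
  have hex : ∃ k, ∃ X : Submodule K V, (∀ n ∈ N, X.map (R n) ≤ X) ∧ X ≠ ⊥ ∧ finrank K X = k :=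
    ⟨_, W, hW, hW0, rfl⟩
  obtain ⟨W₁, hW₁N, hW₁0, hW₁k⟩ := Nat.find_spec hex
  have hmin : ∀ X : Submodule K V, (∀ n ∈ N, X.map (R n) ≤ X) → X ≠ ⊥ →
      finrank K W₁ ≤ finrank K X := fun X hX hX0 => by
    rw [hW₁k]; exact Nat.find_min' hex ⟨X, hX, hX0, rfl⟩
  -- Step 2: the translates `X i = g₀ ^ i • W₁` and the partial sums `D r = X 0 + ⋯ + X r`
  set X : ℕ → Submodule K V := fun i => W₁.map (R (g₀ ^ i)) with hXdef
  have hXN : ∀ i, ∀ n ∈ N, (X i).map (R n) ≤ X i := fun i =>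
    submodule_map_rep_stable_of_normal R N hW₁N _
  have hXrank : ∀ i, finrank K (X i) = finrank K W₁ := fun i =>
    (Submodule.equivMapOfInjective _ (rep_apply_injective R (g₀ ^ i)) W₁).finrank_eq.symm
  have hXT : ∀ i, (X i).map T = X (i + 1) := fun i => by
    simp only [hXdef, hTdef]; rw [← submodule_map_rep_mul, ← pow_succ']
  have hX0 : X 0 = W₁ := by
    simp only [hXdef, pow_zero, map_one, Module.End.one_eq_id, Submodule.map_id]
  obtain ⟨D, hD0, hDs⟩ : ∃ D : ℕ → Submodule K V, D 0 = X 0 ∧ ∀ r, D (r + 1) = D r ⊔ X (r + 1) :=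
    ⟨fun r => Nat.rec (X 0) (fun i Di => Di ⊔ X (i + 1)) r, rfl, fun _ => rfl⟩
  have hDN : ∀ r, ∀ n ∈ N, (D r).map (R n) ≤ D r := by
    intro r n hn
    induction r with
    | zero => rw [hD0]; exact hXN 0 n hn
    | succ r ih => rw [hDs, Submodule.map_sup]; exact sup_le_sup ih (hXN _ n hn)
  have hDT : ∀ r, (D r).map T ≤ D (r + 1) := by
    intro r
    induction r with
    | zero => rw [hD0, hXT, hDs]; exact le_sup_right
    | succ r ih => rw [hDs, Submodule.map_sup, hXT, hDs (r + 1)]; exact sup_le_sup ih le_rfl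
  have hXD : ∀ r, X 0 ≤ D r := by
    intro r
    induction r with
    | zero => rw [hD0]
    | succ r ih => exact ih.trans (hDs r ▸ le_sup_left)
  -- some `X (r + 1)` lies in `D r` (dimension count)
  have hexr : ∃ r, X (r + 1) ≤ D r := by
    refine Classical.by_contradiction fun hcon => ?_
    push Not at hcon
    have hlt : ∀ r, r + finrank K (X 0) ≤ finrank K (D r) := by
      intro r
      induction r with
      | zero => rw [hD0, zero_add]
      | succ r ih =>
          have h1 : D r < D (r + 1) := by
            refine lt_of_le_of_ne (hDs r ▸ le_sup_left) fun h => hcon r ?_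
            rw [h, hDs]; exact le_sup_right
          have h2 := Submodule.finrank_lt_finrank_of_lt h1
          omega
    have h1 := hlt (finrank K V)
    have h2 := Submodule.finrank_le (D (finrank K V))
    have h3 : 0 < finrank K (X 0) :=
      Nat.pos_of_ne_zero fun h => hW₁0 (Submodule.finrank_eq_zero.1 (hX0 ▸ h))
    omega

  -- Step 3: `D r = ⊤` for the least such `r`
  set r := Nat.find hexr with hrdef
  have hr : X (r + 1) ≤ D r := Nat.find_spec hexr
  have hrmin : ∀ s, s < r → ¬ X (s + 1) ≤ D s := fun s hs => Nat.find_min hexr hs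
  have hDtop : D r = ⊤ := by
    refine (hirr (D r) (submodule_map_rep_le_of_generator R N hgen ?_ (hDN r))).resolve_left ?_
    · calc (D r).map (R g₀) ≤ D (r + 1) := hDT r
        _ = D r := by rw [hDs]; exact sup_eq_left.2 hr
    · intro h
      apply hW₁0
      rw [eq_bot_iff, ← h, ← hX0]
      exact hXD r
  -- Step 4: `r ≠ 0`, and `V = X (s + 1) ⊕ D s` for `r = s + 1`
  have hr0 : r ≠ 0 := by
    intro hr0
    apply hW1
    have h1 : W₁ = ⊤ := by rw [← hX0, ← hD0, ← hr0]; exact hDtop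
    apply Submodule.eq_top_of_finrank_eq
    refine le_antisymm (Submodule.finrank_le W) ?_
    have h2 := hmin W hW hW0
    rw [h1, finrank_top] at h2
    exact h2
  obtain ⟨s, hs⟩ : ∃ s, r = s + 1 := ⟨r - 1, by omega⟩
  have hXs : ¬ X (s + 1) ≤ D s := hrmin s (by omega)
  have htop : X (s + 1) ⊔ D s = ⊤ := by rw [sup_comm, ← hDs, ← hs]; exact hDtop
  have hbot : X (s + 1) ⊓ D s = ⊥ := by
    by_contra hne
    apply hXs
    have hYN : ∀ n ∈ N, (X (s + 1) ⊓ D s).map (R n) ≤ X (s + 1) ⊓ D s := fun n hn =>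
      le_inf ((Submodule.map_mono inf_le_left).trans (hXN _ n hn))
        ((Submodule.map_mono inf_le_right).trans (hDN _ n hn))
    have h1 := hmin _ hYN hne
    rw [← hXrank (s + 1)] at h1
    have h2 : X (s + 1) ⊓ D s = X (s + 1) := Submodule.eq_of_le_of_finrank_le inf_le_left h1
    rw [← h2]; exact inf_le_right
  have hc : IsCompl (X (s + 1)) (D s) := ⟨disjoint_iff.2 hbot, codisjoint_iff.2 htop⟩
  -- Step 5: the projection onto `X (s + 1)` along `D s` commutes with `N` but not with `T`
  set p : Module.End K V := (X (s + 1)).projection (D s) hc with hpdef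
  have hpid : IsIdempotentElem p := Submodule.isIdempotentElem_projection hc
  have hpN : ∀ n ∈ N, p * R n = R n * p := by
    intro n hn
    refine ((LinearMap.IsIdempotentElem.commute_iff (T := R n) hpid).2 ⟨?_, ?_⟩).eq
    · rw [hpdef, Submodule.range_projection, Module.End.mem_invtSubmodule_iff_map_le]
      exact hXN _ n hn
    · rw [hpdef, Submodule.ker_projection, Module.End.mem_invtSubmodule_iff_map_le]
      exact hDN _ n hn
  have hpT : T * p ≠ p * T := by
    intro hcomm
    have hXT' : (X (s + 1)).map T ≤ X (s + 1) := by
      rintro _ ⟨x, hx, rfl⟩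
      have hpx : p x = x := by rw [hpdef]; exact Submodule.projection_apply_of_mem_left hc hx
      rw [← hpx, ← Module.End.mul_apply, hcomm, Module.End.mul_apply, hpdef]
      exact Submodule.projection_apply_mem hc _
    rcases hirr _ (submodule_map_rep_le_of_generator R N hgen hXT' (hXN _)) with h | h
    · exact hXs (h ▸ bot_le)
    · apply hW₁0
      rw [eq_bot_iff, ← hbot, h, top_inf_eq, ← hX0]
      exact hXD s
  -- Step 6: conjugation by `T` on the commutant `E` of `R(N)`
  set Φ : Module.End K (Module.End K V) :=
    LinearMap.mulLeft K T ∘ₗ LinearMap.mulRight K T' with hΦdef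
  have hΦ : ∀ f, Φ f = T * f * T' := fun f => by
    simp only [hΦdef, LinearMap.comp_apply, LinearMap.mulLeft_apply, LinearMap.mulRight_apply,
      mul_assoc]
  obtain ⟨E, hmemE⟩ : ∃ E : Submodule K (Module.End K V),
      ∀ f, f ∈ E ↔ ∀ n ∈ N, f * R n = R n * f :=
    ⟨{ carrier := {f | ∀ n ∈ N, f * R n = R n * f}
       add_mem' := fun {a b} ha hb n hn => by
         simp only [Set.mem_setOf_eq] at ha hb
         rw [add_mul, mul_add, ha n hn, hb n hn]
       zero_mem' := fun n hn => by rw [zero_mul, mul_zero]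
       smul_mem' := fun c a ha n hn => by
         simp only [Set.mem_setOf_eq] at ha
         rw [smul_mul_assoc, mul_smul_comm, ha n hn] }, fun f => Iff.rfl⟩
  have hΦE : ∀ f ∈ E, Φ f ∈ E := by
    intro f hf
    rw [hmemE] at hf ⊢
    intro n hn
    have hn' : g₀⁻¹ * n * g₀ ∈ N := Subgroup.Normal.conj_mem' inferInstance n hn g₀
    have h1 : T' * R n = R (g₀⁻¹ * n * g₀) * T' := by
      rw [hT'def, ← map_mul, ← map_mul]; congr 1; group
    have h2 : T * R (g₀⁻¹ * n * g₀) = R n * T := by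
      rw [hTdef, ← map_mul, ← map_mul]; congr 1; group
    rw [hΦ]
    calc T * f * T' * R n = T * f * (T' * R n) := by simp only [mul_assoc]
      _ = T * (f * R (g₀⁻¹ * n * g₀)) * T' := by rw [h1]; simp only [mul_assoc]
      _ = T * (R (g₀⁻¹ * n * g₀) * f) * T' := by rw [hf _ hn']
      _ = T * R (g₀⁻¹ * n * g₀) * (f * T') := by simp only [mul_assoc]
      _ = R n * (T * f * T') := by rw [h2]; simp only [mul_assoc]
  have hΦpow : ∀ (i : ℕ) (f : Module.End K V), (Φ ^ i) f = T ^ i * f * T' ^ i := by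
    intro i
    induction i with
    | zero => intro f; simp
    | succ i ih =>
        intro f
        rw [pow_succ', Module.End.mul_apply, ih, hΦ, pow_succ', pow_succ]
        simp only [mul_assoc]
  have hΦm : ∀ f ∈ E, (Φ ^ m) f = f := by
    intro f hf
    have h1 : R (g₀ ^ m) * f = f * R (g₀ ^ m) := ((hmemE f).1 hf _ hm).symm
    rw [hΦpow, hTdef, hT'def, ← map_pow, ← map_pow, inv_pow, h1, mul_assoc, ← map_mul,
      mul_inv_cancel, map_one, mul_one]
  -- the subspace `E' = (Φ - 1) E` of `E`: `Φ`-stable, without nonzero `Φ`-fixed vectors, nonzero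
  set E' : Submodule K (Module.End K V) := E.map (Φ - 1) with hE'def
  have hmemE' : ∀ h, h ∈ E' ↔ ∃ f ∈ E, Φ f - f = h := fun h => by
    simp only [hE'def, Submodule.mem_map, LinearMap.sub_apply, Module.End.one_apply]
  have hE'E : E' ≤ E := by
    intro h hh
    obtain ⟨f, hf, rfl⟩ := (hmemE' h).1 hh
    exact E.sub_mem (hΦE f hf) hf
  have hE'Φ : ∀ h ∈ E', Φ h ∈ E' := by
    intro h hh
    obtain ⟨f, hf, rfl⟩ := (hmemE' h).1 hh
    rw [map_sub]
    exact (hmemE' _).2 ⟨Φ f, hΦE f hf, rfl⟩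
  have hE'fix : ∀ h ∈ E', Φ h = h → h = 0 := by
    intro h hh hfix
    obtain ⟨f, hf, rfl⟩ := (hmemE' h).1 hh
    have h1 : ∑ i ∈ Finset.range m, (Φ ^ i) (Φ f - f) = 0 := by
      have h3 := Finset.sum_range_sub (fun i => (Φ ^ i) f) m
      rw [hΦm f hf, pow_zero, Module.End.one_apply, sub_self] at h3
      rw [← h3]
      refine Finset.sum_congr rfl fun i _ => ?_
      rw [map_sub, pow_succ, Module.End.mul_apply]
    have h2 : ∀ i, (Φ ^ i) (Φ f - f) = Φ f - f := by
      intro i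
      induction i with
      | zero => simp
      | succ i ih => rw [pow_succ, Module.End.mul_apply, hfix, ih]
    simp only [h2, Finset.sum_const, Finset.card_range] at h1
    rw [← Nat.cast_smul_eq_nsmul K] at h1
    exact (smul_eq_zero.1 h1).resolve_left hm0
  have hE'ne : E' ≠ ⊥ := by
    intro h0
    apply hpT
    have h1 : Φ p - p ∈ E' := (hmemE' _).2 ⟨p, (hmemE p).2 hpN, rfl⟩
    rw [h0, Submodule.mem_bot, sub_eq_zero, hΦ] at h1
    calc T * p = T * p * (T' * T) := by rw [hT'T, mul_one]
      _ = T * p * T' * T := by simp only [mul_assoc]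
      _ = p * T := by rw [h1]
  -- Step 7: an eigenvector `f₁` of `Φ` in `E'`, with eigenvalue `ν ≠ 1`
  haveI : Nontrivial E' := Submodule.nontrivial_iff_ne_bot.2 hE'ne
  obtain ⟨ν, hν⟩ := Module.End.exists_eigenvalue (Φ.restrict hE'Φ)
  obtain ⟨⟨f₁, hf₁E'⟩, hf₁⟩ := hν.exists_hasEigenvector
  have hΦf₁ : Φ f₁ = ν • f₁ := by
    simpa [LinearMap.restrict_apply, Subtype.ext_iff] using hf₁.apply_eq_smul
  have hf₁0 : f₁ ≠ 0 := fun h => hf₁.2 (Subtype.ext h)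
  have hf₁E : f₁ ∈ E := hE'E hf₁E'
  have hν1 : ν ≠ 1 := by
    intro h1
    rw [h1, one_smul] at hΦf₁
    exact hf₁0 (hE'fix f₁ hf₁E' hΦf₁)
  rw [hΦ] at hΦf₁
  have hν0 : ν ≠ 0 := by
    intro h0
    rw [h0, zero_smul] at hΦf₁
    apply hf₁0
    calc f₁ = (T' * T) * f₁ * (T' * T) := by rw [hT'T, one_mul, mul_one]
      _ = T' * (T * f₁ * T') * T := by simp only [mul_assoc]
      _ = 0 := by rw [hΦf₁, mul_zero, zero_mul]
  have hTf : T * f₁ = ν • (f₁ * T) := by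
    calc T * f₁ = T * f₁ * (T' * T) := by rw [hT'T, mul_one]
      _ = (T * f₁ * T') * T := by simp only [mul_assoc]
      _ = ν • (f₁ * T) := by rw [hΦf₁, smul_mul_assoc]
  -- Step 8: `f₁` is invertible (its kernel is `G`-stable and `≠ ⊤`)
  have hkT : (LinearMap.ker f₁).map T ≤ LinearMap.ker f₁ := by
    rintro _ ⟨v, hv, rfl⟩
    rw [SetLike.mem_coe, LinearMap.mem_ker] at hv
    rw [LinearMap.mem_ker]
    have h1 := congrArg (fun φ : Module.End K V => φ v) hTf
    simp only [Module.End.mul_apply, LinearMap.smul_apply, hv, map_zero] at h1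
    exact (smul_eq_zero.1 h1.symm).resolve_left hν0
  have hkN : ∀ n ∈ N, (LinearMap.ker f₁).map (R n) ≤ LinearMap.ker f₁ := by
    intro n hn
    rintro _ ⟨v, hv, rfl⟩
    rw [SetLike.mem_coe, LinearMap.mem_ker] at hv
    rw [LinearMap.mem_ker]
    have h1 := congrArg (fun φ : Module.End K V => φ v) ((hmemE f₁).1 hf₁E n hn)
    simp only [Module.End.mul_apply, hv, map_zero] at h1
    exact h1
  have hker : LinearMap.ker f₁ = ⊥ := by
    rcases hirr (LinearMap.ker f₁) (submodule_map_rep_le_of_generator R N hgen hkT hkN) with h | h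
    · exact h
    · exact absurd (LinearMap.ker_eq_top.1 h) hf₁0
  obtain ⟨u, hu⟩ : IsUnit f₁ := (LinearMap.isUnit_iff_ker_eq_bot f₁).2 hker
  have hTu : ↑u⁻¹ * T * ↑u = ν • T := by
    rw [mul_assoc, hu, hTf, mul_smul_comm, ← mul_assoc, ← hu, Units.inv_mul, one_mul]
  have hTju : ∀ j : ℕ, ↑u⁻¹ * T ^ j * ↑u = ν ^ j • T ^ j := by
    intro j
    induction j with
    | zero => simp
    | succ j ih =>
        calc ↑u⁻¹ * T ^ (j + 1) * ↑u = (↑u⁻¹ * T ^ j * ↑u) * (↑u⁻¹ * T * ↑u) := by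
              rw [pow_succ]; simp only [mul_assoc, Units.mul_inv_cancel_left]
          _ = ν ^ (j + 1) • T ^ (j + 1) := by
              rw [ih, hTu, smul_mul_smul_comm, ← pow_succ, ← pow_succ]
  have hnu : ∀ n ∈ N, ↑u⁻¹ * R n * ↑u = R n := by
    intro n hn
    have hf₁n : f₁ * R n = R n * f₁ := (hmemE f₁).1 hf₁E n hn
    rw [mul_assoc, hu, ← hf₁n, ← mul_assoc, ← hu, Units.inv_mul, one_mul]
  -- Step 9: the twist identities
  refine ⟨ν, hν1, ?_, fun j n hn => ?_⟩
  · have hdT : LinearMap.det T ≠ 0 := by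
      intro h0
      have h1 := congrArg LinearMap.det hTT'
      rw [map_mul, h0, zero_mul, map_one] at h1
      exact zero_ne_one h1
    have h1 := congrArg LinearMap.det hTu
    rw [LinearMap.det_smul, map_mul, map_mul, mul_right_comm, ← map_mul, Units.inv_mul, map_one,
      one_mul] at h1
    exact (mul_eq_right₀ hdT).1 h1.symm
  · have hg : R (g₀ ^ j * n) = T ^ j * R n := by rw [map_mul, map_pow, hTdef]
    have hconj : ↑u⁻¹ * R (g₀ ^ j * n) * ↑u = ν ^ j • R (g₀ ^ j * n) := by
      rw [hg]
      calc ↑u⁻¹ * (T ^ j * R n) * ↑u = (↑u⁻¹ * T ^ j * ↑u) * (↑u⁻¹ * R n * ↑u) := by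
            simp only [mul_assoc, Units.mul_inv_cancel_left]
        _ = ν ^ j • (T ^ j * R n) := by rw [hTju, hnu n hn, smul_mul_assoc]
    have htr : LinearMap.trace K V (↑u⁻¹ * R (g₀ ^ j * n) * ↑u) =
        LinearMap.trace K V (R (g₀ ^ j * n)) := by
      rw [mul_assoc, LinearMap.trace_mul_comm, mul_assoc, Units.mul_inv, mul_one]
    calc LinearMap.trace K V (R (g₀ ^ j * n))
        = LinearMap.trace K V (↑u⁻¹ * R (g₀ ^ j * n) * ↑u) := htr.symm
      _ = ν ^ j * LinearMap.trace K V (R (g₀ ^ j * n)) := by rw [hconj, map_smul, smul_eq_mul]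

end CliffordCyclicTwist

end Literature.RepresentationTheory.Semisimple
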